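import Summits.BirchSwinnertonDyer.BirchSwinnertonDyer.Theorems.ResidualThetaTransportAtTwoThetaLayerLambdaCongruenceAtTwoLevelCoeffBound
import Summits.BirchSwinnertonDyer.BirchSwinnertonDyer.Theorems.ResidualThetaTransportAtTwoThetaLayerLambdaCongruenceAtTwoStarPlusLineResidual
import Literature.NumberTheory.EllipticCurves.NoConductorOne
import HarnessLib

/-!
# Crux `ThetaLayerLambdaCongruenceAtTwo`, line `birth`: THE CRUX from named facts + (μ-W₁) (the plus-line stub removed)

Helper / composition file for `stmt-BirchSwinnertonDyer-20688` (no definition; the crux is NOT closed: one research input,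
(μ-W₁), remains a hypothesis, and seven named facts are hypotheses).  The lead's composition of skeleton v9,
`…LevelCoeffBound.thetaLayerLambdaCongruenceAtTwo_of_plusLine_curveMax_deligne' : (C3) → (μ-W₁) → Deligne → crux`, consumes
the plus-line statement (C3) quantified over ALL odd levels `N'` divisible by the primes of `N_W`, but applies it only at
`N' = N_W·M·∏_{v∈S₀} ℓ_v²` (`…RescaledPlusLine`).  At such levels (C3) is now a THEOREM modulo named facts
(`…StarPlusLineCharTwo.plusLineCharTwo_of_facts` + `…StarPlusLineResidual.plusLineAtTwoLevel_of_charTwoLevel`), under the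
level hypotheses «newform `f` of `W`, finite set of primes `S ⊇ primes(N')` with `N_W·∏_{ℓ∈S} ℓ² ∣ N'`, good reduction off
`2N'`».  This file re-threads the lead's glue with these hypotheses:

* §1 `thetaLayerLambdaCongruenceAtTwo_of_plusLineLevel_curveMax_nonvanishing` — verbatim
  `…RescaledPlusLine.thetaLayerLambdaCongruenceAtTwo_of_plusLine_curveMax_nonvanishing` except that the level data are
  produced at the crux's level: `S = {ℓ_v : v ∈ S₀}` (`exists_mem_natGenerator_eq_of_dvd`; nonempty as `N_W ≠ 1`,
  `conductorNorm_ne_one`), `N_W·∏_{ℓ∈S} ℓ² ∣ N_W·M·∏_v ℓ_v²`, and good reduction off `2N'` (bad places lie in `S₀`).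
* §2 the wrappers `…_nonRoot`, `…_deligne`, `…_deligne'` of `…DepletionInjective`, `…EulerFactorNonRoot`, `…LevelCoeffBound`
  with the re-threaded hypothesis.
* §3 `thetaLayerLambdaCongruenceAtTwo_of_facts_curveMax_deligne`: THE CRUX from the six named facts of the plus line,
  Deligne's fact, and (μ-W₁).

BSD is not proved by any of this.
-/

noncomputable section

-- justification: the `Summit.BirchSwinnertonDyer.BirchSwinnertonDyer.…` path repeats a component (route-file convention)
set_option linter.dupNamespace false

open scoped Classical MatrixGroups Polynomial

open Literature.NumberTheory.EllipticCurves Literature.NumberTheory.EllipticCurves.ModularForms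
open Literature.NumberTheory.IwasawaTheory

namespace Summit.BirchSwinnertonDyer.BirchSwinnertonDyer.Theorems.ThetaLayerLambdaCongruenceAtTwo

/-! ## §1 The rescaled-plus-line glue with the level data produced at the crux's level -/

section Glue

/-- **THE CRUX from (C3⁺) + (μ-W₁) + (NZ-g)** — the lead's `thetaLayerLambdaCongruenceAtTwo_of_plusLine_curveMax_nonvanishing`
(`…RescaledPlusLine`) with the plus-line hypothesis weakened to the crux's levels: (C3⁺) asks, besides `N'` odd, for a
newform `f` of `W` of level `N`, a nonempty finite set of primes `S ⊇ primes(N')` with `N·∏_{ℓ∈S} ℓ² ∣ N'`, and good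
reduction of `W` off `2N'`; at `N' = N_W·M·∏_{v∈S₀} ℓ_v²` these hold with `S = {ℓ_v}` (bad places and the places over `M`
lie in `S₀`).  Otherwise verbatim.  [cite: GreenbergVatsal2000, §1 (10) and Prop. (2.4) (shape; the inputs are hypotheses)] -/
theorem thetaLayerLambdaCongruenceAtTwo_of_plusLineLevel_curveMax_nonvanishing
    (hC3 : ∀ (W : WeierstrassCurve ℚ) [W.IsElliptic] [W.IsGloballyMinimal], Literature.NumberTheory.EllipticCurves.Rank1Residual.GoodSS W 2 → W.Δ < 0 → ∀ (N' : ℕ), Odd N' → ∀ {N : ℕ} [NeZero N] (f : CuspForm (CongruenceSubgroup.Gamma0 N) 2), Literature.NumberTheory.EllipticCurves.ModularForms.IsNewformOf W f → ∀ (S : Finset ℕ), (∀ ℓ ∈ S, ℓ.Prime) → S.Nonempty → N * ∏ ℓ ∈ S, ℓ ^ 2 ∣ N' → (∀ p : ℕ, p.Prime → p ∣ N' → p ∈ S) → (∀ v : IsDedekindDomain.HeightOneSpectrum (NumberField.RingOfIntegers ℚ), ¬ ((Rat.HeightOneSpectrum.primesEquiv v : ℕ) ∣ 2 * N') → W.HasGoodReductionAt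 v) → ∀ (Φ₁ Φ₂ : ℚ → PadicAlgCl 2), (∀ (r : ℚ) (z : ℤ), Φ₁ (r + z) = Φ₁ r) → (∀ r : ℚ, Φ₁ (-r) = Φ₁ r) → (∀ (γ : CongruenceSubgroup.Gamma0 (N')) (r : ℚ), ((γ : SL(2, ℤ)) 1 0 : ℚ) * r + ((γ : SL(2, ℤ)) 1 1 : ℚ) ≠ 0 → Φ₁ ((((γ : SL(2, ℤ)) 0 0 : ℚ) * r + ((γ : SL(2, ℤ)) 0 1 : ℚ)) / (((γ : SL(2, ℤ)) 1 0 : ℚ) * r + ((γ : SL(2, ℤ)) 1 1 : ℚ))) = (if ((γ : SL(2, ℤ)) 1 0) = 0 then 0 else Φ₁ ((((γ : SL(2, ℤ)) 0 0 : ℚ)) / (((γ : SL(2, ℤ)) 1 0 : ℚ)))) + Φ₁ r) → (∀ (r : ℚ) (z : ℤ), Φ₂ (r + z) = Φ₂ r) → (∀ r : ℚ, Φ₂ (-r) = Φ₂ r) → (∀ (γ : CongruenceSubgroup.Gamma0 (N')) (r : ℚ), ((γ : SL(2, ℤ)) 1 0 : ℚ) * r + ((γ : SL(2, ℤ)) 1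 1 : ℚ) ≠ 0 → Φ₂ ((((γ : SL(2, ℤ)) 0 0 : ℚ) * r + ((γ : SL(2, ℤ)) 0 1 : ℚ)) / (((γ : SL(2, ℤ)) 1 0 : ℚ) * r + ((γ : SL(2, ℤ)) 1 1 : ℚ))) = (if ((γ : SL(2, ℤ)) 1 0) = 0 then 0 else Φ₂ ((((γ : SL(2, ℤ)) 0 0 : ℚ)) / (((γ : SL(2, ℤ)) 1 0 : ℚ)))) + Φ₂ r) → (∀ r : ℚ, ‖Φ₁ r‖ ≤ 1) → (∀ r : ℚ, ‖Φ₂ r‖ ≤ 1) → (∃ r : ℚ, ‖Φ₁ r‖ = 1) → (∃ r : ℚ, ‖Φ₂ r‖ = 1) → (∀ q : ℕ, q.Prime → ¬ q ∣ N' → ∀ r : ℚ, ‖(∑ j : Fin q, Φ₁ ((r + j) / q)) + Φ₁ (q * r) - (W.LFunction q : PadicAlgCl 2) * Φ₁ r‖ < 1) → (∀ q : ℕ, q.Prime → ¬ q ∣ N' → ∀ r : ℚ, ‖(∑ j : Fin q, Φ₂ ((r + j) / q)) + Φ₂ (q * r) - (W.LFunction q : PadicAlgCl 2) * Φ₂ r‖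 < 1) → (∀ ℓ : ℕ, ℓ.Prime → ℓ ∣ N' → ∀ r : ℚ, ‖∑ j : Fin ℓ, Φ₁ ((r + j) / ℓ)‖ < 1) → (∀ ℓ : ℕ, ℓ.Prime → ℓ ∣ N' → ∀ r : ℚ, ‖∑ j : Fin ℓ, Φ₂ ((r + j) / ℓ)‖ < 1) → ∃ a : PadicAlgCl 2, ∀ r : ℚ, ‖a * Φ₁ r - Φ₂ r‖ < 1)
    (hμW : ∀ (W : WeierstrassCurve ℚ) [W.IsElliptic] [W.IsGloballyMinimal], ¬ W.HasCM → W.analyticRank = 0 → Literature.NumberTheory.EllipticCurves.Rank1Residual.GoodSS W 2 → W.frobeniusTrace 2 = 0 → W.Δ < 0 → ∀ [NeZero (W.conductorNorm ℤ)] (f : CuspForm (CongruenceSubgroup.Gamma0 (W.conductorNorm ℤ)) 2), Literature.NumberTheory.EllipticCurves.ModularForms.IsNewformOf W f → ∀ (S₀ : Finset (IsDedekindDomain.HeightOneSpectrum (NumberField.RingOfIntegers ℚ))), (∀ v ∈ S₀, ((2 : ℕ) : NumberField.RingOfIntegers ℚ) ∉ v.asIdeal) → (∀ v : IsDedekindDomain.HeightOneSpectrum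 (NumberField.RingOfIntegers ℚ), ¬ W.HasGoodReductionAt v → v ∈ S₀) → ∃ n₁ : ℕ, Even n₁ ∧ ∃ s : ZMod (2 ^ n₁), ∀ r : ℚ, ‖(∑ k ∈ Fintype.piFinset (fun _ : S₀ ↦ Finset.range 3), (∏ v : S₀, ((W.localPolynomialAt (v : IsDedekindDomain.HeightOneSpectrum (NumberField.RingOfIntegers ℚ))).map (Int.castRingHom (PadicAlgCl 2))).coeff (k v) * ((Rat.HeightOneSpectrum.natGenerator (v : IsDedekindDomain.HeightOneSpectrum (NumberField.RingOfIntegers ℚ)) : PadicAlgCl 2)⁻¹) ^ (k v)) * algebraMap ℚ (PadicAlgCl 2) (ratPlusSymbol f (r * ((∏ v : S₀, Rat.HeightOneSpectrum.natGenerator (v : IsDedekindDomain.HeightOneSpectrum (NumberField.RingOfIntegers ℚ)) ^ (k v) : ℕ) : ℚ))))‖ ≤ ‖(∑ k ∈ Fintype.piFinset (fun _ : S₀ ↦ Finset.range 3), (∏ v : S₀, ((W.localPolynomialAt (v : IsDedekindDomain.HeightOneSpectrum (NumberField.RingOfIntegers ℚ))).map (Int.castRingHom (PadicAlgCl 2))).coeff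 (k v) * ((Rat.HeightOneSpectrum.natGenerator (v : IsDedekindDomain.HeightOneSpectrum (NumberField.RingOfIntegers ℚ)) : PadicAlgCl 2)⁻¹) ^ (k v)) * algebraMap ℚ (PadicAlgCl 2) (ratPlusSymbol f ((((((Literature.NumberTheory.EllipticCurves.cyclotomicGenerator 2 : ZMod (2 ^ (n₁ + 2))) ^ s.val).val : ℚ) / (2 : ℚ) ^ (n₁ + 2))) * ((∏ v : S₀, Rat.HeightOneSpectrum.natGenerator (v : IsDedekindDomain.HeightOneSpectrum (NumberField.RingOfIntegers ℚ)) ^ (k v) : ℕ) : ℚ))))‖)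
    (hNZ : ∀ (W : WeierstrassCurve ℚ) [W.IsElliptic] [W.IsGloballyMinimal], ¬ W.HasCM → W.analyticRank = 0 → Literature.NumberTheory.EllipticCurves.Rank1Residual.GoodSS W 2 → W.frobeniusTrace 2 = 0 → W.Δ < 0 → ∀ (M : ℕ) [NeZero M] (g : CuspForm (CongruenceSubgroup.Gamma0 M) 2) (ι : Literature.NumberTheory.EllipticCurves.ModularForms.coeffField g →+* PadicAlgCl 2) (Ω : ℂ), Odd M → Literature.NumberTheory.EllipticCurves.ModularForms.IsNewform0 g → Literature.NumberTheory.Automorphic.IsCMForm (Literature.NumberTheory.EllipticCurves.ModularForms.liftToGamma1 M 2 g) → Literature.NumberTheory.EllipticCurves.ModularForms.cuspCoeff g 2 = 0 → Literature.NumberTheory.EllipticCurves.IsPlusPeriod g Ω → (∀ ℓ : ℕ, ℓ.Prime → ¬ ℓ ∣ 2 * M * W.conductorNorm ℤ → ‖Literature.NumberTheory.EllipticCurves.embCoeff g ι ℓ - (W.frobeniusTrace ℓ : PadicAlgCl 2)‖ < 1) → ∀ [NeZero (W.conductorNorm ℤ)] (f : CuspForm (CongruenceSubgroup.Gamma0 (W.conductorNorm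 ℤ)) 2), Literature.NumberTheory.EllipticCurves.ModularForms.IsNewformOf W f → ∀ (S₀ : Finset (IsDedekindDomain.HeightOneSpectrum (NumberField.RingOfIntegers ℚ))), (∀ v ∈ S₀, ((2 : ℕ) : NumberField.RingOfIntegers ℚ) ∉ v.asIdeal) → (∀ v : IsDedekindDomain.HeightOneSpectrum (NumberField.RingOfIntegers ℚ), ¬ W.HasGoodReductionAt v → v ∈ S₀) → (∀ v : IsDedekindDomain.HeightOneSpectrum (NumberField.RingOfIntegers ℚ), Rat.HeightOneSpectrum.natGenerator v ∣ M → v ∈ S₀) → ∃ r : ℚ, (∑ k ∈ Fintype.piFinset (fun _ : S₀ ↦ Finset.range 3), (∏ v : S₀, (1 - Polynomial.C (embCoeff g ι (Rat.HeightOneSpectrum.natGenerator (v : IsDedekindDomain.HeightOneSpectrum (NumberField.RingOfIntegers ℚ)))) * Polynomial.X + (if Rat.HeightOneSpectrum.natGenerator (v : IsDedekindDomain.HeightOneSpectrum (NumberField.RingOfIntegers ℚ)) ∣ M then 0 else Polynomial.C (Rat.HeightOneSpectrum.natGenerator (v : IsDedekindDomain.HeightOneSpectrum (NumberField.RingOfIntegers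 ℚ)) : PadicAlgCl 2)) * Polynomial.X ^ 2 : Polynomial (PadicAlgCl 2)).coeff (k v) * ((Rat.HeightOneSpectrum.natGenerator (v : IsDedekindDomain.HeightOneSpectrum (NumberField.RingOfIntegers ℚ)) : PadicAlgCl 2)⁻¹) ^ (k v)) * ι (plusSymbolK g Ω (r * ((∏ v : S₀, Rat.HeightOneSpectrum.natGenerator (v : IsDedekindDomain.HeightOneSpectrum (NumberField.RingOfIntegers ℚ)) ^ (k v) : ℕ) : ℚ)))) ≠ 0) :
    Summit.BirchSwinnertonDyer.BirchSwinnertonDyer.Theses.ResidualThetaTransportAtTwo.ThetaLayerLambdaCongruenceAtTwo := by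
  refine thetaLayerLambdaCongruenceAtTwo_of_frequently_relCongruent ?_
  intro W _ _ hcm hr hss ha hΔ M _ g ι Ω hodd hnew hcmg ha2 hΩ hcong _ f hf S₀ hS2 hSW hSM N₀
  have h2M : ¬ 2 ∣ M := hodd.not_two_dvd_nat
  -- the curve side: primitive scaling `c` (w2)
  obtain ⟨c, hcint, x, hx⟩ := exists_primitive_scaling_depletedCurveSymbol hf hr S₀ hS2
  -- the partner side: a value of maximal norm and the rescaling `y`
  obtain ⟨r₀, hr₀, hmaxg⟩ := exists_max_depletedPartnerSymbol ι Ω S₀ hnew hΩ hS2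
    (hNZ W hcm hr hss ha hΔ M g ι Ω hodd hnew hcmg ha2 hΩ hcong f hf S₀ hS2 hSW hSM)
  obtain ⟨y, hy⟩ : ∃ y : PadicAlgCl 2, y = ((∑ k ∈ Fintype.piFinset (fun _ : S₀ ↦ Finset.range 3), (∏ v : S₀, (1 - Polynomial.C (embCoeff g ι (Rat.HeightOneSpectrum.natGenerator (v : IsDedekindDomain.HeightOneSpectrum (NumberField.RingOfIntegers ℚ)))) * Polynomial.X + (if Rat.HeightOneSpectrum.natGenerator (v : IsDedekindDomain.HeightOneSpectrum (NumberField.RingOfIntegers ℚ)) ∣ M then 0 else Polynomial.C (Rat.HeightOneSpectrum.natGenerator (v : IsDedekindDomain.HeightOneSpectrum (NumberField.RingOfIntegers ℚ)) : PadicAlgCl 2)) * Polynomial.X ^ 2 : Polynomial (PadicAlgCl 2)).coeff (k v) * ((Rat.HeightOneSpectrum.natGenerator (v : IsDedekindDomain.HeightOneSpectrum (NumberField.RingOfIntegers ℚ)) : PadicAlgCl 2)⁻¹) ^ (k v)) * ι (plusSymbolK g Ω (r₀ * ((∏ v : S₀, Rat.HeightOneSpectrum.natGenerator (v : IsDedekindDomain.HeightOneSpectrum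 (NumberField.RingOfIntegers ℚ)) ^ (k v) : ℕ) : ℚ)))))⁻¹ := ⟨_, rfl⟩
  have hy0 : y ≠ 0 := by rw [hy]; exact inv_ne_zero hr₀
  have hgint : ∀ r : ℚ, ‖y * (∑ k ∈ Fintype.piFinset (fun _ : S₀ ↦ Finset.range 3), (∏ v : S₀, (1 - Polynomial.C (embCoeff g ι (Rat.HeightOneSpectrum.natGenerator (v : IsDedekindDomain.HeightOneSpectrum (NumberField.RingOfIntegers ℚ)))) * Polynomial.X + (if Rat.HeightOneSpectrum.natGenerator (v : IsDedekindDomain.HeightOneSpectrum (NumberField.RingOfIntegers ℚ)) ∣ M then 0 else Polynomial.C (Rat.HeightOneSpectrum.natGenerator (v : IsDedekindDomain.HeightOneSpectrum (NumberField.RingOfIntegers ℚ)) : PadicAlgCl 2)) * Polynomial.X ^ 2 : Polynomial (PadicAlgCl 2)).coeff (k v) * ((Rat.HeightOneSpectrum.natGenerator (v : IsDedekindDomain.HeightOneSpectrum (NumberField.RingOfIntegers ℚ)) : PadicAlgCl 2)⁻¹) ^ (k v)) * ι (plusSymbolK g Ω (r * ((∏ v : S₀, Rat.HeightOneSpectrum.natGenerator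 (v : IsDedekindDomain.HeightOneSpectrum (NumberField.RingOfIntegers ℚ)) ^ (k v) : ℕ) : ℚ))))‖ ≤ 1 := fun r ↦ by
    rw [hy, norm_mul, norm_inv, inv_mul_le_iff₀ (norm_pos_iff.mpr hr₀), mul_one]
    exact hmaxg r
  have hgunit : ‖y * (∑ k ∈ Fintype.piFinset (fun _ : S₀ ↦ Finset.range 3), (∏ v : S₀, (1 - Polynomial.C (embCoeff g ι (Rat.HeightOneSpectrum.natGenerator (v : IsDedekindDomain.HeightOneSpectrum (NumberField.RingOfIntegers ℚ)))) * Polynomial.X + (if Rat.HeightOneSpectrum.natGenerator (v : IsDedekindDomain.HeightOneSpectrum (NumberField.RingOfIntegers ℚ)) ∣ M then 0 else Polynomial.C (Rat.HeightOneSpectrum.natGenerator (v : IsDedekindDomain.HeightOneSpectrum (NumberField.RingOfIntegers ℚ)) : PadicAlgCl 2)) * Polynomial.X ^ 2 : Polynomial (PadicAlgCl 2)).coeff (k v) * ((Rat.HeightOneSpectrum.natGenerator (v : IsDedekindDomain.HeightOneSpectrum (NumberField.RingOfIntegers ℚ)) : PadicAlgCl 2)⁻¹) ^ (k v)) * ι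 (plusSymbolK g Ω (r₀ * ((∏ v : S₀, Rat.HeightOneSpectrum.natGenerator (v : IsDedekindDomain.HeightOneSpectrum (NumberField.RingOfIntegers ℚ)) ^ (k v) : ℕ) : ℚ))))‖ = 1 := by rw [hy, inv_mul_cancel₀ hr₀, norm_one]
  -- the depleted level `N' = N_W · M · ∏ ℓ_v²` and the hypotheses of (C3)
  have hN'odd := odd_depletedLevel W hss hodd S₀ hS2
  -- the level data of (C3⁺) at `N' = N_W · M · ∏ ℓ_v²`
  obtain ⟨SS, hSSdef⟩ : ∃ SS : Finset ℕ, SS = S₀.image (fun v ↦ Rat.HeightOneSpectrum.natGenerator v) := ⟨_, rfl⟩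
  have hSS : ∀ ℓ ∈ SS, ℓ.Prime := by
    intro ℓ hℓ
    rw [hSSdef] at hℓ
    obtain ⟨v, -, rfl⟩ := Finset.mem_image.mp hℓ
    exact Rat.HeightOneSpectrum.prime_natGenerator v
  have hLS : ∀ p : ℕ, p.Prime → p ∣ W.conductorNorm ℤ * M * (∏ v : S₀, Rat.HeightOneSpectrum.natGenerator (v : IsDedekindDomain.HeightOneSpectrum (NumberField.RingOfIntegers ℚ)) ^ 2) → p ∈ SS := by
    intro p hp hdvd
    obtain ⟨v₀, hv₀, hv₀p⟩ := exists_mem_natGenerator_eq_of_dvd W S₀ hSW hSM hp hdvd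
    rw [hSSdef]
    exact Finset.mem_image.mpr ⟨v₀, hv₀, hv₀p⟩
  have hSSne : SS.Nonempty := by
    have h1 : W.conductorNorm ℤ * M * (∏ v : S₀, Rat.HeightOneSpectrum.natGenerator (v : IsDedekindDomain.HeightOneSpectrum (NumberField.RingOfIntegers ℚ)) ^ 2) ≠ 1 := by
      intro h
      exact WeierstrassCurve.conductorNorm_ne_one W (Nat.eq_one_of_mul_eq_one_right (Nat.eq_one_of_mul_eq_one_right h))
    obtain ⟨p, hp, hpd⟩ := Nat.exists_prime_and_dvd h1
    exact ⟨p, hLS p hp hpd⟩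
  have hNL : W.conductorNorm ℤ * ∏ ℓ ∈ SS, ℓ ^ 2 ∣ W.conductorNorm ℤ * M * (∏ v : S₀, Rat.HeightOneSpectrum.natGenerator (v : IsDedekindDomain.HeightOneSpectrum (NumberField.RingOfIntegers ℚ)) ^ 2) := by
    have hinj : Set.InjOn (fun v : IsDedekindDomain.HeightOneSpectrum (NumberField.RingOfIntegers ℚ) ↦ Rat.HeightOneSpectrum.natGenerator v) S₀ :=
      fun v _ w _ h ↦ Rat.HeightOneSpectrum.primesEquiv.injective (Subtype.ext h)
    rw [hSSdef, Finset.prod_image hinj, ← Finset.prod_coe_sort S₀]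
    exact ⟨M, by ring⟩
  have hgoodL : ∀ v : IsDedekindDomain.HeightOneSpectrum (NumberField.RingOfIntegers ℚ), ¬ ((Rat.HeightOneSpectrum.primesEquiv v : ℕ) ∣ 2 * (W.conductorNorm ℤ * M * (∏ v : S₀, Rat.HeightOneSpectrum.natGenerator (v : IsDedekindDomain.HeightOneSpectrum (NumberField.RingOfIntegers ℚ)) ^ 2))) → W.HasGoodReductionAt v := by
    intro v hv
    by_contra hbad
    apply hv
    have h1 : Rat.HeightOneSpectrum.natGenerator v ∣ ∏ w ∈ S₀, Rat.HeightOneSpectrum.natGenerator w ^ 2 :=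
      (dvd_pow_self _ two_ne_zero).trans
        (Finset.dvd_prod_of_mem (fun w ↦ Rat.HeightOneSpectrum.natGenerator w ^ 2) (hSW v hbad))
    rw [Finset.prod_coe_sort S₀ (fun w ↦ Rat.HeightOneSpectrum.natGenerator w ^ 2)]
    exact Dvd.dvd.mul_left (Dvd.dvd.mul_left h1 _) 2
  have hdvdW : W.conductorNorm ℤ * (∏ v : S₀, Rat.HeightOneSpectrum.natGenerator (v : IsDedekindDomain.HeightOneSpectrum (NumberField.RingOfIntegers ℚ)) ^ 2) ∣ W.conductorNorm ℤ * M * (∏ v : S₀, Rat.HeightOneSpectrum.natGenerator (v : IsDedekindDomain.HeightOneSpectrum (NumberField.RingOfIntegers ℚ)) ^ 2) := ⟨M, by ring⟩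
  have hdvdM : M * (∏ v : S₀, Rat.HeightOneSpectrum.natGenerator (v : IsDedekindDomain.HeightOneSpectrum (NumberField.RingOfIntegers ℚ)) ^ 2) ∣ W.conductorNorm ℤ * M * (∏ v : S₀, Rat.HeightOneSpectrum.natGenerator (v : IsDedekindDomain.HeightOneSpectrum (NumberField.RingOfIntegers ℚ)) ^ 2) := ⟨W.conductorNorm ℤ, by ring⟩
  have hoff : ∀ q : ℕ, ¬ q ∣ W.conductorNorm ℤ * M * (∏ v : S₀, Rat.HeightOneSpectrum.natGenerator (v : IsDedekindDomain.HeightOneSpectrum (NumberField.RingOfIntegers ℚ)) ^ 2) →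
      ¬ q ∣ W.conductorNorm ℤ ∧ ¬ q ∣ M ∧ ∀ v ∈ S₀, Rat.HeightOneSpectrum.natGenerator v ≠ q :=
    fun q hnd ↦ off_depletedLevel W M S₀ hnd
  obtain ⟨a, ha'⟩ := hC3 W hss hΔ _ hN'odd f hf SS hSS hSSne hNL hLS hgoodL
    (fun x ↦ c * (fun x ↦ (∑ k ∈ Fintype.piFinset (fun _ : S₀ ↦ Finset.range 3), (∏ v : S₀, ((W.localPolynomialAt (v : IsDedekindDomain.HeightOneSpectrum (NumberField.RingOfIntegers ℚ))).map (Int.castRingHom (PadicAlgCl 2))).coeff (k v) * ((Rat.HeightOneSpectrum.natGenerator (v : IsDedekindDomain.HeightOneSpectrum (NumberField.RingOfIntegers ℚ)) : PadicAlgCl 2)⁻¹) ^ (k v)) * algebraMap ℚ (PadicAlgCl 2) (ratPlusSymbol f (x * ((∏ v : S₀, Rat.HeightOneSpectrum.natGenerator (v : IsDedekindDomain.HeightOneSpectrum (NumberField.RingOfIntegers ℚ)) ^ (k v) : ℕ) : ℚ))))) x) (fun x ↦ y * (fun x ↦ (∑ k ∈ Fintype.piFinset (fun _ : S₀ ↦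 Finset.range 3), (∏ v : S₀, (1 - Polynomial.C (embCoeff g ι (Rat.HeightOneSpectrum.natGenerator (v : IsDedekindDomain.HeightOneSpectrum (NumberField.RingOfIntegers ℚ)))) * Polynomial.X + (if Rat.HeightOneSpectrum.natGenerator (v : IsDedekindDomain.HeightOneSpectrum (NumberField.RingOfIntegers ℚ)) ∣ M then 0 else Polynomial.C (Rat.HeightOneSpectrum.natGenerator (v : IsDedekindDomain.HeightOneSpectrum (NumberField.RingOfIntegers ℚ)) : PadicAlgCl 2)) * Polynomial.X ^ 2 : Polynomial (PadicAlgCl 2)).coeff (k v) * ((Rat.HeightOneSpectrum.natGenerator (v : IsDedekindDomain.HeightOneSpectrum (NumberField.RingOfIntegers ℚ)) : PadicAlgCl 2)⁻¹) ^ (k v)) * ι (plusSymbolK g Ω (x * ((∏ v : S₀, Rat.HeightOneSpectrum.natGenerator (v : IsDedekindDomain.HeightOneSpectrum (NumberField.RingOfIntegers ℚ)) ^ (k v) : ℕ) : ℚ))))) x)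
    (depletedCurveSymbol_add_intCast W S₀ c) (depletedCurveSymbol_neg W S₀ c)
    (depletedCurveSymbol_gamma0_smul_of_dvd hf c hdvdW)
    (fun r z ↦ congrArg (fun t ↦ y * t) (depletedPartnerSymbol_add_intCast g ι Ω S₀ r z))
    (fun r ↦ congrArg (fun t ↦ y * t) (depletedPartnerSymbol_neg g ι Ω S₀ r))
    (gamma0_smul_const_mul y (fun x ↦ (∑ k ∈ Fintype.piFinset (fun _ : S₀ ↦ Finset.range 3), (∏ v : S₀, (1 - Polynomial.C (embCoeff g ι (Rat.HeightOneSpectrum.natGenerator (v : IsDedekindDomain.HeightOneSpectrum (NumberField.RingOfIntegers ℚ)))) * Polynomial.X + (if Rat.HeightOneSpectrum.natGenerator (v : IsDedekindDomain.HeightOneSpectrum (NumberField.RingOfIntegers ℚ)) ∣ M then 0 else Polynomial.C (Rat.HeightOneSpectrum.natGenerator (v : IsDedekindDomain.HeightOneSpectrum (NumberField.RingOfIntegers ℚ)) : PadicAlgCl 2)) * Polynomial.X ^ 2 : Polynomial (PadicAlgCl 2)).coeff (k v) * ((Rat.HeightOneSpectrum.natGenerator (v : IsDedekindDomain.HeightOneSpectrum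 (NumberField.RingOfIntegers ℚ)) : PadicAlgCl 2)⁻¹) ^ (k v)) * ι (plusSymbolK g Ω (x * ((∏ v : S₀, Rat.HeightOneSpectrum.natGenerator (v : IsDedekindDomain.HeightOneSpectrum (NumberField.RingOfIntegers ℚ)) ^ (k v) : ℕ) : ℚ))))) (depletedPartnerSymbol_gamma0_smul_of_dvd g ι Ω S₀ hΩ hdvdM))
    hcint hgint ⟨x, hx⟩ ⟨r₀, hgunit⟩
    (fun q hq hnd r ↦ by
      rw [depletedCurveSymbol_heckeT_sub_eq_zero hf c hq (hoff q hnd).1 (hoff q hnd).2.2 r, norm_zero]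
      exact zero_lt_one)
    (fun q hq hnd r ↦ by
      simp only
      exact rescaled_depletedPartnerSymbol_heckeT_sub_lt_one g ι Ω S₀ hnew hΩ W ha2 ha hcong hSW hSM hgint hq
        (hoff q hnd).2.1 (hoff q hnd).2.2 r)
    (fun ℓ hℓ hd r ↦ by
      rw [depletedCurveSymbol_heckeU_eq_zero hf c hSW hSM hℓ hd r, norm_zero]; exact zero_lt_one)
    (fun ℓ hℓ hd r ↦ by
      have h0 := depletedPartnerSymbol_heckeU_eq_zero g ι Ω S₀ hnew hΩ W hSW hSM hℓ hd r
      simp only at h0 ⊢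
      rw [← Finset.mul_sum, h0, mul_zero, norm_zero]
      exact zero_lt_one)
  simp only at ha'
  -- `a` is a unit
  have ha1 : ‖a‖ = 1 :=
    norm_eq_one_of_congr_of_primitive (Φ₁ := fun x ↦ c * (∑ k ∈ Fintype.piFinset (fun _ : S₀ ↦ Finset.range 3), (∏ v : S₀, ((W.localPolynomialAt (v : IsDedekindDomain.HeightOneSpectrum (NumberField.RingOfIntegers ℚ))).map (Int.castRingHom (PadicAlgCl 2))).coeff (k v) * ((Rat.HeightOneSpectrum.natGenerator (v : IsDedekindDomain.HeightOneSpectrum (NumberField.RingOfIntegers ℚ)) : PadicAlgCl 2)⁻¹) ^ (k v)) * algebraMap ℚ (PadicAlgCl 2) (ratPlusSymbol f (x * ((∏ v : S₀, Rat.HeightOneSpectrum.natGenerator (v : IsDedekindDomain.HeightOneSpectrum (NumberField.RingOfIntegers ℚ)) ^ (k v) : ℕ) : ℚ))))) (Φ₂ := fun x ↦ y * (∑ k ∈ Fintype.piFinset (fun _ : S₀ ↦ Finset.range 3), (∏ v : S₀, (1 - Polynomial.C (embCoeff g ι (Rat.HeightOneSpectrum.natGenerator (v : IsDedekindDomain.HeightOneSpectrum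 (NumberField.RingOfIntegers ℚ)))) * Polynomial.X + (if Rat.HeightOneSpectrum.natGenerator (v : IsDedekindDomain.HeightOneSpectrum (NumberField.RingOfIntegers ℚ)) ∣ M then 0 else Polynomial.C (Rat.HeightOneSpectrum.natGenerator (v : IsDedekindDomain.HeightOneSpectrum (NumberField.RingOfIntegers ℚ)) : PadicAlgCl 2)) * Polynomial.X ^ 2 : Polynomial (PadicAlgCl 2)).coeff (k v) * ((Rat.HeightOneSpectrum.natGenerator (v : IsDedekindDomain.HeightOneSpectrum (NumberField.RingOfIntegers ℚ)) : PadicAlgCl 2)⁻¹) ^ (k v)) * ι (plusSymbolK g Ω (x * ((∏ v : S₀, Rat.HeightOneSpectrum.natGenerator (v : IsDedekindDomain.HeightOneSpectrum (NumberField.RingOfIntegers ℚ)) ^ (k v) : ℕ) : ℚ)))))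
      hcint hgint ⟨x, hx⟩ ⟨r₀, hgunit⟩ ha'
  -- (μ-W₁): the curve side is a unit at the layer-`n₁` cusp `s₁`, hence so is the rescaled partner side
  obtain ⟨n₁, hn₁e, s₁, hmaxW⟩ := hμW W hcm hr hss ha hΔ f hf S₀ hS2 hSW
  haveI : NeZero (2 ^ n₁) := ⟨pow_ne_zero _ two_ne_zero⟩
  have hW1 : ‖c * (∑ k ∈ Fintype.piFinset (fun _ : S₀ ↦ Finset.range 3), (∏ v : S₀, ((W.localPolynomialAt (v : IsDedekindDomain.HeightOneSpectrum (NumberField.RingOfIntegers ℚ))).map (Int.castRingHom (PadicAlgCl 2))).coeff (k v) * ((Rat.HeightOneSpectrum.natGenerator (v : IsDedekindDomain.HeightOneSpectrum (NumberField.RingOfIntegers ℚ)) : PadicAlgCl 2)⁻¹) ^ (k v)) * algebraMap ℚ (PadicAlgCl 2) (ratPlusSymbol f ((((((Literature.NumberTheory.EllipticCurves.cyclotomicGenerator 2 : ZMod (2 ^ (n₁ + 2))) ^ s₁.val).val : ℚ) / (2 : ℚ) ^ (n₁ + 2))) * ((∏ v : S₀, Rat.HeightOneSpectrum.natGenerator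 (v : IsDedekindDomain.HeightOneSpectrum (NumberField.RingOfIntegers ℚ)) ^ (k v) : ℕ) : ℚ))))‖ = 1 := by
    refine le_antisymm (hcint _) ?_
    rw [← hx, norm_mul, norm_mul]
    exact mul_le_mul_of_nonneg_left (hmaxW x) (norm_nonneg c)
  have hG1 : ‖y * (∑ k ∈ Fintype.piFinset (fun _ : S₀ ↦ Finset.range 3), (∏ v : S₀, (1 - Polynomial.C (embCoeff g ι (Rat.HeightOneSpectrum.natGenerator (v : IsDedekindDomain.HeightOneSpectrum (NumberField.RingOfIntegers ℚ)))) * Polynomial.X + (if Rat.HeightOneSpectrum.natGenerator (v : IsDedekindDomain.HeightOneSpectrum (NumberField.RingOfIntegers ℚ)) ∣ M then 0 else Polynomial.C (Rat.HeightOneSpectrum.natGenerator (v : IsDedekindDomain.HeightOneSpectrum (NumberField.RingOfIntegers ℚ)) : PadicAlgCl 2)) * Polynomial.X ^ 2 : Polynomial (PadicAlgCl 2)).coeff (k v) * ((Rat.HeightOneSpectrum.natGenerator (v : IsDedekindDomain.HeightOneSpectrum (NumberField.RingOfIntegers ℚ)) : PadicAlgCl 2)⁻¹) ^ (k v)) *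 ι (plusSymbolK g Ω (((((Literature.NumberTheory.EllipticCurves.cyclotomicGenerator 2 : ZMod (2 ^ (n₁ + 2))) ^ s₁.val).val : ℚ) / (2 : ℚ) ^ (n₁ + 2)) * ((∏ v : S₀, Rat.HeightOneSpectrum.natGenerator (v : IsDedekindDomain.HeightOneSpectrum (NumberField.RingOfIntegers ℚ)) ^ (k v) : ℕ) : ℚ))))‖ = 1 :=
    (norm_eq_one_iff_of_unit_congr ha1 (hcint _) (hgint _) (ha' _)).mp hW1
  -- propagate the unit to a layer `n₁ + 2i ≥ N₀` and conclude (R∞) there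
  obtain ⟨i, hi⟩ : ∃ i : ℕ, N₀ ≤ n₁ + 2 * i := ⟨N₀, by omega⟩
  obtain ⟨s, hs⟩ := exists_unit_add_two_mul g ι Ω S₀ hnew h2M ha2 hΩ hS2 hgint n₁ ⟨s₁, hG1⟩ i
  refine ⟨n₁ + 2 * i, hi, hn₁e.add (even_two_mul i), a * c * y⁻¹, ?_⟩
  refine relCongruent_of_symbolCongr_of_unit W f g ι Ω S₀ hS2 (n₁ + 2 * i) hy0 hgint (fun t ↦ ?_) ⟨s, hs⟩
  rw [mul_assoc]
  exact ha' _

end Glue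

/-! ## §2 The wrappers of the v9 composition, re-threaded -/

section Wrappers

/-- Re-threaded `…DepletionInjective.thetaLayerLambdaCongruenceAtTwo_of_plusLine_curveMax_nonRoot`: the crux from (C3⁺),
(μ-W₁) and (NR-g) (no root of unity times `ℓ⁻¹` is a root of the partner's Euler factor).
[cite: Deligne1974, Thm. 8.2; AtkinLehner1970, Thm. 3; GreenbergVatsal2000, §1 (10) (shape; the inputs are hypotheses)] -/
theorem thetaLayerLambdaCongruenceAtTwo_of_plusLineLevel_curveMax_nonRoot
    (hC3 : ∀ (W : WeierstrassCurve ℚ) [W.IsElliptic] [W.IsGloballyMinimal], Literature.NumberTheory.EllipticCurves.Rank1Residual.GoodSS W 2 → W.Δ < 0 → ∀ (N' : ℕ), Odd N' → ∀ {N : ℕ} [NeZero N] (f : CuspForm (CongruenceSubgroup.Gamma0 N) 2), Literature.NumberTheory.EllipticCurves.ModularForms.IsNewformOf W f → ∀ (S : Finset ℕ), (∀ ℓ ∈ S, ℓ.Prime) → S.Nonempty → N * ∏ ℓ ∈ S, ℓ ^ 2 ∣ N' → (∀ p : ℕ, p.Prime → p ∣ N' → p ∈ S) → (∀ v : IsDedekindDomain.HeightOneSpectrum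 (NumberField.RingOfIntegers ℚ), ¬ ((Rat.HeightOneSpectrum.primesEquiv v : ℕ) ∣ 2 * N') → W.HasGoodReductionAt v) → ∀ (Φ₁ Φ₂ : ℚ → PadicAlgCl 2), (∀ (r : ℚ) (z : ℤ), Φ₁ (r + z) = Φ₁ r) → (∀ r : ℚ, Φ₁ (-r) = Φ₁ r) → (∀ (γ : CongruenceSubgroup.Gamma0 (N')) (r : ℚ), ((γ : SL(2, ℤ)) 1 0 : ℚ) * r + ((γ : SL(2, ℤ)) 1 1 : ℚ) ≠ 0 → Φ₁ ((((γ : SL(2, ℤ)) 0 0 : ℚ) * r + ((γ : SL(2, ℤ)) 0 1 : ℚ)) / (((γ : SL(2, ℤ)) 1 0 : ℚ) * r + ((γ : SL(2, ℤ)) 1 1 : ℚ))) = (if ((γ : SL(2, ℤ)) 1 0) = 0 then 0 else Φ₁ ((((γ : SL(2, ℤ)) 0 0 : ℚ)) / (((γ : SL(2, ℤ)) 1 0 : ℚ)))) + Φ₁ r) → (∀ (r : ℚ) (z : ℤ), Φ₂ (r + z) = Φ₂ r) → (∀ r : ℚ, Φ₂ (-r) = Φ₂ r) → (∀ (γ :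 CongruenceSubgroup.Gamma0 (N')) (r : ℚ), ((γ : SL(2, ℤ)) 1 0 : ℚ) * r + ((γ : SL(2, ℤ)) 1 1 : ℚ) ≠ 0 → Φ₂ ((((γ : SL(2, ℤ)) 0 0 : ℚ) * r + ((γ : SL(2, ℤ)) 0 1 : ℚ)) / (((γ : SL(2, ℤ)) 1 0 : ℚ) * r + ((γ : SL(2, ℤ)) 1 1 : ℚ))) = (if ((γ : SL(2, ℤ)) 1 0) = 0 then 0 else Φ₂ ((((γ : SL(2, ℤ)) 0 0 : ℚ)) / (((γ : SL(2, ℤ)) 1 0 : ℚ)))) + Φ₂ r) → (∀ r : ℚ, ‖Φ₁ r‖ ≤ 1) → (∀ r : ℚ, ‖Φ₂ r‖ ≤ 1) → (∃ r : ℚ, ‖Φ₁ r‖ = 1) → (∃ r : ℚ, ‖Φ₂ r‖ = 1) → (∀ q : ℕ, q.Prime → ¬ q ∣ N' → ∀ r : ℚ, ‖(∑ j : Fin q, Φ₁ ((r + j) / q)) + Φ₁ (q * r) - (W.LFunction q : PadicAlgCl 2) * Φ₁ r‖ < 1) → (∀ q : ℕ, q.Prime → ¬ q ∣ N' → ∀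 r : ℚ, ‖(∑ j : Fin q, Φ₂ ((r + j) / q)) + Φ₂ (q * r) - (W.LFunction q : PadicAlgCl 2) * Φ₂ r‖ < 1) → (∀ ℓ : ℕ, ℓ.Prime → ℓ ∣ N' → ∀ r : ℚ, ‖∑ j : Fin ℓ, Φ₁ ((r + j) / ℓ)‖ < 1) → (∀ ℓ : ℕ, ℓ.Prime → ℓ ∣ N' → ∀ r : ℚ, ‖∑ j : Fin ℓ, Φ₂ ((r + j) / ℓ)‖ < 1) → ∃ a : PadicAlgCl 2, ∀ r : ℚ, ‖a * Φ₁ r - Φ₂ r‖ < 1)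
    (hμW : ∀ (W : WeierstrassCurve ℚ) [W.IsElliptic] [W.IsGloballyMinimal], ¬ W.HasCM → W.analyticRank = 0 → Literature.NumberTheory.EllipticCurves.Rank1Residual.GoodSS W 2 → W.frobeniusTrace 2 = 0 → W.Δ < 0 → ∀ [NeZero (W.conductorNorm ℤ)] (f : CuspForm (CongruenceSubgroup.Gamma0 (W.conductorNorm ℤ)) 2), Literature.NumberTheory.EllipticCurves.ModularForms.IsNewformOf W f → ∀ (S₀ : Finset (IsDedekindDomain.HeightOneSpectrum (NumberField.RingOfIntegers ℚ))), (∀ v ∈ S₀, ((2 : ℕ) : NumberField.RingOfIntegers ℚ) ∉ v.asIdeal) → (∀ v : IsDedekindDomain.HeightOneSpectrum (NumberField.RingOfIntegers ℚ), ¬ W.HasGoodReductionAt v → v ∈ S₀) → ∃ n₁ : ℕ, Even n₁ ∧ ∃ s : ZMod (2 ^ n₁), ∀ r : ℚ, ‖(∑ k ∈ Fintype.piFinset (fun _ : S₀ ↦ Finset.range 3), (∏ v : S₀, ((W.localPolynomialAt (v : IsDedekindDomain.HeightOneSpectrum (NumberField.RingOfIntegers ℚ))).map (Int.castRingHom (PadicAlgCl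 2))).coeff (k v) * ((Rat.HeightOneSpectrum.natGenerator (v : IsDedekindDomain.HeightOneSpectrum (NumberField.RingOfIntegers ℚ)) : PadicAlgCl 2)⁻¹) ^ (k v)) * algebraMap ℚ (PadicAlgCl 2) (ratPlusSymbol f (r * ((∏ v : S₀, Rat.HeightOneSpectrum.natGenerator (v : IsDedekindDomain.HeightOneSpectrum (NumberField.RingOfIntegers ℚ)) ^ (k v) : ℕ) : ℚ))))‖ ≤ ‖(∑ k ∈ Fintype.piFinset (fun _ : S₀ ↦ Finset.range 3), (∏ v : S₀, ((W.localPolynomialAt (v : IsDedekindDomain.HeightOneSpectrum (NumberField.RingOfIntegers ℚ))).map (Int.castRingHom (PadicAlgCl 2))).coeff (k v) * ((Rat.HeightOneSpectrum.natGenerator (v : IsDedekindDomain.HeightOneSpectrum (NumberField.RingOfIntegers ℚ)) : PadicAlgCl 2)⁻¹) ^ (k v)) * algebraMap ℚ (PadicAlgCl 2) (ratPlusSymbol f ((((((Literature.NumberTheory.EllipticCurves.cyclotomicGenerator 2 : ZMod (2 ^ (n₁ + 2))) ^ s.val).val : ℚ) / (2 : ℚ) ^ (n₁ + 2))) * ((∏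 v : S₀, Rat.HeightOneSpectrum.natGenerator (v : IsDedekindDomain.HeightOneSpectrum (NumberField.RingOfIntegers ℚ)) ^ (k v) : ℕ) : ℚ))))‖)
    (hNR : ∀ (M : ℕ) [NeZero M] (g : CuspForm (CongruenceSubgroup.Gamma0 M) 2)
      (ι : Literature.NumberTheory.EllipticCurves.ModularForms.coeffField g →+* PadicAlgCl 2),
      Literature.NumberTheory.EllipticCurves.ModularForms.IsNewform0 g → ∀ ℓ : ℕ, ℓ.Prime → ∀ ζ : PadicAlgCl 2,
      (∃ m : ℕ, 0 < m ∧ ζ ^ m = 1) →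
        Polynomial.eval (ζ * ((ℓ : PadicAlgCl 2))⁻¹) (1 - Polynomial.C (embCoeff g ι ℓ) * Polynomial.X +
          (if ℓ ∣ M then 0 else Polynomial.C (ℓ : PadicAlgCl 2)) * Polynomial.X ^ 2 : Polynomial (PadicAlgCl 2)) ≠ 0) :
    Summit.BirchSwinnertonDyer.BirchSwinnertonDyer.Theses.ResidualThetaTransportAtTwo.ThetaLayerLambdaCongruenceAtTwo :=
  thetaLayerLambdaCongruenceAtTwo_of_plusLineLevel_curveMax_nonvanishing hC3 hμW
    (fun _W _ _ _ _ _ _ _ M _ g ι Ω _ hnew _ _ hΩ _ _ _ _ S₀ _ _ _ ↦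
      exists_depletedPartnerSymbol_ne_zero_of_nonRoot ι Ω S₀ hnew hΩ
        (fun v _ ζ hζ ↦ hNR M g ι hnew _ (Rat.HeightOneSpectrum.prime_natGenerator v) ζ hζ))

/-- Re-threaded `…EulerFactorNonRoot.thetaLayerLambdaCongruenceAtTwo_of_plusLine_curveMax_deligne`: the crux from (C3⁺),
(μ-W₁), Deligne's named fact and the Atkin–Lehner level bound (AL).
[cite: Deligne1974, Thm. (8.2); AtkinLehner1970, Thm. 3; GreenbergVatsal2000, §1 (10) (shape; the inputs are hypotheses)] -/
theorem thetaLayerLambdaCongruenceAtTwo_of_plusLineLevel_curveMax_deligne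
    (hC3 : ∀ (W : WeierstrassCurve ℚ) [W.IsElliptic] [W.IsGloballyMinimal], Literature.NumberTheory.EllipticCurves.Rank1Residual.GoodSS W 2 → W.Δ < 0 → ∀ (N' : ℕ), Odd N' → ∀ {N : ℕ} [NeZero N] (f : CuspForm (CongruenceSubgroup.Gamma0 N) 2), Literature.NumberTheory.EllipticCurves.ModularForms.IsNewformOf W f → ∀ (S : Finset ℕ), (∀ ℓ ∈ S, ℓ.Prime) → S.Nonempty → N * ∏ ℓ ∈ S, ℓ ^ 2 ∣ N' → (∀ p : ℕ, p.Prime → p ∣ N' → p ∈ S) → (∀ v : IsDedekindDomain.HeightOneSpectrum (NumberField.RingOfIntegers ℚ), ¬ ((Rat.HeightOneSpectrum.primesEquiv v : ℕ) ∣ 2 * N') → W.HasGoodReductionAt v) → ∀ (Φ₁ Φ₂ : ℚ → PadicAlgCl 2), (∀ (r : ℚ) (z : ℤ), Φ₁ (r + z) = Φ₁ r) → (∀ r : ℚ, Φ₁ (-r) = Φ₁ r) → (∀ (γ : CongruenceSubgroup.Gamma0 (N')) (r : ℚ), ((γ : SL(2, ℤ)) 1 0 : ℚ) * r + ((γ :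 SL(2, ℤ)) 1 1 : ℚ) ≠ 0 → Φ₁ ((((γ : SL(2, ℤ)) 0 0 : ℚ) * r + ((γ : SL(2, ℤ)) 0 1 : ℚ)) / (((γ : SL(2, ℤ)) 1 0 : ℚ) * r + ((γ : SL(2, ℤ)) 1 1 : ℚ))) = (if ((γ : SL(2, ℤ)) 1 0) = 0 then 0 else Φ₁ ((((γ : SL(2, ℤ)) 0 0 : ℚ)) / (((γ : SL(2, ℤ)) 1 0 : ℚ)))) + Φ₁ r) → (∀ (r : ℚ) (z : ℤ), Φ₂ (r + z) = Φ₂ r) → (∀ r : ℚ, Φ₂ (-r) = Φ₂ r) → (∀ (γ : CongruenceSubgroup.Gamma0 (N')) (r : ℚ), ((γ : SL(2, ℤ)) 1 0 : ℚ) * r + ((γ : SL(2, ℤ)) 1 1 : ℚ) ≠ 0 → Φ₂ ((((γ : SL(2, ℤ)) 0 0 : ℚ) * r + ((γ : SL(2, ℤ)) 0 1 : ℚ)) / (((γ : SL(2, ℤ)) 1 0 : ℚ) * r + ((γ : SL(2, ℤ)) 1 1 : ℚ))) = (if ((γ : SL(2, ℤ)) 1 0) = 0 then 0 else Φ₂ ((((γ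 : SL(2, ℤ)) 0 0 : ℚ)) / (((γ : SL(2, ℤ)) 1 0 : ℚ)))) + Φ₂ r) → (∀ r : ℚ, ‖Φ₁ r‖ ≤ 1) → (∀ r : ℚ, ‖Φ₂ r‖ ≤ 1) → (∃ r : ℚ, ‖Φ₁ r‖ = 1) → (∃ r : ℚ, ‖Φ₂ r‖ = 1) → (∀ q : ℕ, q.Prime → ¬ q ∣ N' → ∀ r : ℚ, ‖(∑ j : Fin q, Φ₁ ((r + j) / q)) + Φ₁ (q * r) - (W.LFunction q : PadicAlgCl 2) * Φ₁ r‖ < 1) → (∀ q : ℕ, q.Prime → ¬ q ∣ N' → ∀ r : ℚ, ‖(∑ j : Fin q, Φ₂ ((r + j) / q)) + Φ₂ (q * r) - (W.LFunction q : PadicAlgCl 2) * Φ₂ r‖ < 1) → (∀ ℓ : ℕ, ℓ.Prime → ℓ ∣ N' → ∀ r : ℚ, ‖∑ j : Fin ℓ, Φ₁ ((r + j) / ℓ)‖ < 1) → (∀ ℓ : ℕ, ℓ.Prime → ℓ ∣ N' → ∀ r : ℚ, ‖∑ j : Fin ℓ, Φ₂ ((r + j) / ℓ)‖ < 1) → ∃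 a : PadicAlgCl 2, ∀ r : ℚ, ‖a * Φ₁ r - Φ₂ r‖ < 1)
    (hμW : ∀ (W : WeierstrassCurve ℚ) [W.IsElliptic] [W.IsGloballyMinimal], ¬ W.HasCM → W.analyticRank = 0 → Literature.NumberTheory.EllipticCurves.Rank1Residual.GoodSS W 2 → W.frobeniusTrace 2 = 0 → W.Δ < 0 → ∀ [NeZero (W.conductorNorm ℤ)] (f : CuspForm (CongruenceSubgroup.Gamma0 (W.conductorNorm ℤ)) 2), Literature.NumberTheory.EllipticCurves.ModularForms.IsNewformOf W f → ∀ (S₀ : Finset (IsDedekindDomain.HeightOneSpectrum (NumberField.RingOfIntegers ℚ))), (∀ v ∈ S₀, ((2 : ℕ) : NumberField.RingOfIntegers ℚ) ∉ v.asIdeal) → (∀ v : IsDedekindDomain.HeightOneSpectrum (NumberField.RingOfIntegers ℚ), ¬ W.HasGoodReductionAt v → v ∈ S₀) → ∃ n₁ : ℕ, Even n₁ ∧ ∃ s : ZMod (2 ^ n₁), ∀ r : ℚ, ‖(∑ k ∈ Fintype.piFinset (fun _ : S₀ ↦ Finset.range 3), (∏ v : S₀, ((W.localPolynomialAt (v :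 IsDedekindDomain.HeightOneSpectrum (NumberField.RingOfIntegers ℚ))).map (Int.castRingHom (PadicAlgCl 2))).coeff (k v) * ((Rat.HeightOneSpectrum.natGenerator (v : IsDedekindDomain.HeightOneSpectrum (NumberField.RingOfIntegers ℚ)) : PadicAlgCl 2)⁻¹) ^ (k v)) * algebraMap ℚ (PadicAlgCl 2) (ratPlusSymbol f (r * ((∏ v : S₀, Rat.HeightOneSpectrum.natGenerator (v : IsDedekindDomain.HeightOneSpectrum (NumberField.RingOfIntegers ℚ)) ^ (k v) : ℕ) : ℚ))))‖ ≤ ‖(∑ k ∈ Fintype.piFinset (fun _ : S₀ ↦ Finset.range 3), (∏ v : S₀, ((W.localPolynomialAt (v : IsDedekindDomain.HeightOneSpectrum (NumberField.RingOfIntegers ℚ))).map (Int.castRingHom (PadicAlgCl 2))).coeff (k v) * ((Rat.HeightOneSpectrum.natGenerator (v : IsDedekindDomain.HeightOneSpectrum (NumberField.RingOfIntegers ℚ)) : PadicAlgCl 2)⁻¹) ^ (k v)) * algebraMap ℚ (PadicAlgCl 2) (ratPlusSymbol f ((((((Literature.NumberTheory.EllipticCurves.cyclotomicGenerator 2 :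 ZMod (2 ^ (n₁ + 2))) ^ s.val).val : ℚ) / (2 : ℚ) ^ (n₁ + 2))) * ((∏ v : S₀, Rat.HeightOneSpectrum.natGenerator (v : IsDedekindDomain.HeightOneSpectrum (NumberField.RingOfIntegers ℚ)) ^ (k v) : ℕ) : ℚ))))‖)
    (hD : Deligne1974_heckeT_eigenvalue_norm_le)
    (hAL : ∀ (N : ℕ) [NeZero N] (f : CuspForm (CongruenceSubgroup.Gamma0 N) 2), IsNewform0 f →
      ∀ ℓ : ℕ, ℓ.Prime → ℓ ∣ N → ‖cuspCoeff f ℓ‖ ≤ 1) :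
    Summit.BirchSwinnertonDyer.BirchSwinnertonDyer.Theses.ResidualThetaTransportAtTwo.ThetaLayerLambdaCongruenceAtTwo :=
  thetaLayerLambdaCongruenceAtTwo_of_plusLineLevel_curveMax_nonRoot hC3 hμW fun M _ g ι hg ℓ hℓ ζ hζ ↦ by
    by_cases hℓM : ℓ ∣ M
    · exact eval_partnerEulerPolynomial_ne_zero_of_levelCoeffBound ι hℓ hℓM (hAL M g hg ℓ hℓ hℓM) ζ hζ
    · exact eval_partnerEulerPolynomial_ne_zero_of_deligne ι hD hg hℓ hℓM ζ hζ

/-- Re-threaded `…LevelCoeffBound.thetaLayerLambdaCongruenceAtTwo_of_plusLine_curveMax_deligne'`: the crux from (C3⁺),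
(μ-W₁) and Deligne's named fact ((AL) discharged by `norm_cuspCoeff_le_one_of_dvd_level`).
[cite: Deligne1974, Thm. (8.2); GreenbergVatsal2000, §1 (10) (shape; the inputs are hypotheses)] -/
theorem thetaLayerLambdaCongruenceAtTwo_of_plusLineLevel_curveMax_deligne'
    (hC3 : ∀ (W : WeierstrassCurve ℚ) [W.IsElliptic] [W.IsGloballyMinimal], Literature.NumberTheory.EllipticCurves.Rank1Residual.GoodSS W 2 → W.Δ < 0 → ∀ (N' : ℕ), Odd N' → ∀ {N : ℕ} [NeZero N] (f : CuspForm (CongruenceSubgroup.Gamma0 N) 2), Literature.NumberTheory.EllipticCurves.ModularForms.IsNewformOf W f → ∀ (S : Finset ℕ), (∀ ℓ ∈ S, ℓ.Prime) → S.Nonempty → N * ∏ ℓ ∈ S, ℓ ^ 2 ∣ N' → (∀ p : ℕ, p.Prime → p ∣ N' → p ∈ S) → (∀ v : IsDedekindDomain.HeightOneSpectrum (NumberField.RingOfIntegers ℚ), ¬ ((Rat.HeightOneSpectrum.primesEquiv v : ℕ) ∣ 2 * N') → W.HasGoodReductionAt v) → ∀ (Φ₁ Φ₂ : ℚ → PadicAlgCl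 2), (∀ (r : ℚ) (z : ℤ), Φ₁ (r + z) = Φ₁ r) → (∀ r : ℚ, Φ₁ (-r) = Φ₁ r) → (∀ (γ : CongruenceSubgroup.Gamma0 (N')) (r : ℚ), ((γ : SL(2, ℤ)) 1 0 : ℚ) * r + ((γ : SL(2, ℤ)) 1 1 : ℚ) ≠ 0 → Φ₁ ((((γ : SL(2, ℤ)) 0 0 : ℚ) * r + ((γ : SL(2, ℤ)) 0 1 : ℚ)) / (((γ : SL(2, ℤ)) 1 0 : ℚ) * r + ((γ : SL(2, ℤ)) 1 1 : ℚ))) = (if ((γ : SL(2, ℤ)) 1 0) = 0 then 0 else Φ₁ ((((γ : SL(2, ℤ)) 0 0 : ℚ)) / (((γ : SL(2, ℤ)) 1 0 : ℚ)))) + Φ₁ r) → (∀ (r : ℚ) (z : ℤ), Φ₂ (r + z) = Φ₂ r) → (∀ r : ℚ, Φ₂ (-r) = Φ₂ r) → (∀ (γ : CongruenceSubgroup.Gamma0 (N')) (r : ℚ), ((γ : SL(2, ℤ)) 1 0 : ℚ) * r + ((γ : SL(2, ℤ)) 1 1 : ℚ) ≠ 0 → Φ₂ ((((γ : SL(2,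 ℤ)) 0 0 : ℚ) * r + ((γ : SL(2, ℤ)) 0 1 : ℚ)) / (((γ : SL(2, ℤ)) 1 0 : ℚ) * r + ((γ : SL(2, ℤ)) 1 1 : ℚ))) = (if ((γ : SL(2, ℤ)) 1 0) = 0 then 0 else Φ₂ ((((γ : SL(2, ℤ)) 0 0 : ℚ)) / (((γ : SL(2, ℤ)) 1 0 : ℚ)))) + Φ₂ r) → (∀ r : ℚ, ‖Φ₁ r‖ ≤ 1) → (∀ r : ℚ, ‖Φ₂ r‖ ≤ 1) → (∃ r : ℚ, ‖Φ₁ r‖ = 1) → (∃ r : ℚ, ‖Φ₂ r‖ = 1) → (∀ q : ℕ, q.Prime → ¬ q ∣ N' → ∀ r : ℚ, ‖(∑ j : Fin q, Φ₁ ((r + j) / q)) + Φ₁ (q * r) - (W.LFunction q : PadicAlgCl 2) * Φ₁ r‖ < 1) → (∀ q : ℕ, q.Prime → ¬ q ∣ N' → ∀ r : ℚ, ‖(∑ j : Fin q, Φ₂ ((r + j) / q)) + Φ₂ (q * r) - (W.LFunction q : PadicAlgCl 2) * Φ₂ r‖ < 1) → (∀ ℓ : ℕ, ℓ.Prime → ℓ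 ∣ N' → ∀ r : ℚ, ‖∑ j : Fin ℓ, Φ₁ ((r + j) / ℓ)‖ < 1) → (∀ ℓ : ℕ, ℓ.Prime → ℓ ∣ N' → ∀ r : ℚ, ‖∑ j : Fin ℓ, Φ₂ ((r + j) / ℓ)‖ < 1) → ∃ a : PadicAlgCl 2, ∀ r : ℚ, ‖a * Φ₁ r - Φ₂ r‖ < 1)
    (hμW : ∀ (W : WeierstrassCurve ℚ) [W.IsElliptic] [W.IsGloballyMinimal], ¬ W.HasCM → W.analyticRank = 0 → Literature.NumberTheory.EllipticCurves.Rank1Residual.GoodSS W 2 → W.frobeniusTrace 2 = 0 → W.Δ < 0 → ∀ [NeZero (W.conductorNorm ℤ)] (f : CuspForm (CongruenceSubgroup.Gamma0 (W.conductorNorm ℤ)) 2), Literature.NumberTheory.EllipticCurves.ModularForms.IsNewformOf W f → ∀ (S₀ : Finset (IsDedekindDomain.HeightOneSpectrum (NumberField.RingOfIntegers ℚ))), (∀ v ∈ S₀, ((2 : ℕ) : NumberField.RingOfIntegers ℚ) ∉ v.asIdeal) → (∀ v : IsDedekindDomain.HeightOneSpectrum (NumberField.RingOfIntegers ℚ),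 ¬ W.HasGoodReductionAt v → v ∈ S₀) → ∃ n₁ : ℕ, Even n₁ ∧ ∃ s : ZMod (2 ^ n₁), ∀ r : ℚ, ‖(∑ k ∈ Fintype.piFinset (fun _ : S₀ ↦ Finset.range 3), (∏ v : S₀, ((W.localPolynomialAt (v : IsDedekindDomain.HeightOneSpectrum (NumberField.RingOfIntegers ℚ))).map (Int.castRingHom (PadicAlgCl 2))).coeff (k v) * ((Rat.HeightOneSpectrum.natGenerator (v : IsDedekindDomain.HeightOneSpectrum (NumberField.RingOfIntegers ℚ)) : PadicAlgCl 2)⁻¹) ^ (k v)) * algebraMap ℚ (PadicAlgCl 2) (ratPlusSymbol f (r * ((∏ v : S₀, Rat.HeightOneSpectrum.natGenerator (v : IsDedekindDomain.HeightOneSpectrum (NumberField.RingOfIntegers ℚ)) ^ (k v) : ℕ) : ℚ))))‖ ≤ ‖(∑ k ∈ Fintype.piFinset (fun _ : S₀ ↦ Finset.range 3), (∏ v : S₀, ((W.localPolynomialAt (v : IsDedekindDomain.HeightOneSpectrum (NumberField.RingOfIntegers ℚ))).map (Int.castRingHom (PadicAlgCl 2))).coeff (k v) * ((Rat.HeightOneSpectrum.natGenerator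 (v : IsDedekindDomain.HeightOneSpectrum (NumberField.RingOfIntegers ℚ)) : PadicAlgCl 2)⁻¹) ^ (k v)) * algebraMap ℚ (PadicAlgCl 2) (ratPlusSymbol f ((((((Literature.NumberTheory.EllipticCurves.cyclotomicGenerator 2 : ZMod (2 ^ (n₁ + 2))) ^ s.val).val : ℚ) / (2 : ℚ) ^ (n₁ + 2))) * ((∏ v : S₀, Rat.HeightOneSpectrum.natGenerator (v : IsDedekindDomain.HeightOneSpectrum (NumberField.RingOfIntegers ℚ)) ^ (k v) : ℕ) : ℚ))))‖)
    (hD : Deligne1974_heckeT_eigenvalue_norm_le) :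
    Summit.BirchSwinnertonDyer.BirchSwinnertonDyer.Theses.ResidualThetaTransportAtTwo.ThetaLayerLambdaCongruenceAtTwo :=
  thetaLayerLambdaCongruenceAtTwo_of_plusLineLevel_curveMax_deligne hC3 hμW hD
    fun _N _ _f hf _ℓ hℓ hℓN ↦ norm_cuspCoeff_le_one_of_dvd_level hf hℓ hℓN

end Wrappers

/-! ## §3 THE CRUX from named facts + (μ-W₁) -/

section Facts

/-- **THE CRUX `ThetaLayerLambdaCongruenceAtTwo` BY NAME from SIX NAMED FACTS + (μ-W₁) + DELIGNE.**  The
plus-line input of line `birth` is no longer a stub: (C3) at the crux's levels is `plusLineCharTwo_of_facts`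
(`…StarPlusLineCharTwo`, characteristic `2`) transported by `plusLineAtTwoLevel_of_charTwoLevel` (`…StarPlusLineResidual`),
resting on the named facts `eichlerShimura_depletedOptimalQuotient_periodLattice_of_dvd` (Eichler–Shimura / optimal
quotients of depleted forms), `WeierstrassCurve.isIsogenous_iff_frobeniusTrace_eq` (Faltings),
`mazurKenku_exists_cyclic_isogeny` (Mazur–Kenku), `heckeSelfDual_torsionBy_J0` (Hecke self-duality of `J₀[2]`),
`buzzard2000_multiplicityOne_gamma0` (Buzzard's mod-`2` multiplicity one) and
`serre1972_supersingular_decompositionSubgroup_image` (Serre 1972 Prop. 12); the partner-side input is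
`Deligne1974_heckeT_eigenvalue_norm_le` (Weil I, Thm. 8.2).  What remains research is the single curve-side statement
(μ-W₁) `stub_curveDepletedSymbolMaxAtTwoPowerCusp` («`W`'s depleted rational plus symbol attains its `2`-adic maximum at
a `2`-power cusp of some even layer»; per-curve finite check).  BSD is not proved by this.
[cite: GreenbergVatsal2000, §1 (10) and Prop. (2.4) (shape)] [cite: Buzzard2000LevelLoweringModTwo, Prop. 2.4]
[cite: Deligne1974, Thm. (8.2)] -/
theorem thetaLayerLambdaCongruenceAtTwo_of_facts_curveMax_deligne
    (hES : eichlerShimura_depletedOptimalQuotient_periodLattice_of_dvd)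
    (hF : WeierstrassCurve.isIsogenous_iff_frobeniusTrace_eq) (hMK : mazurKenku_exists_cyclic_isogeny)
    (hSD : heckeSelfDual_torsionBy_J0) (hBz : buzzard2000_multiplicityOne_gamma0)
    (hSe : serre1972_supersingular_decompositionSubgroup_image)
    (hμW : ∀ (W : WeierstrassCurve ℚ) [W.IsElliptic] [W.IsGloballyMinimal], ¬ W.HasCM → W.analyticRank = 0 → Literature.NumberTheory.EllipticCurves.Rank1Residual.GoodSS W 2 → W.frobeniusTrace 2 = 0 → W.Δ < 0 → ∀ [NeZero (W.conductorNorm ℤ)] (f : CuspForm (CongruenceSubgroup.Gamma0 (W.conductorNorm ℤ)) 2), Literature.NumberTheory.EllipticCurves.ModularForms.IsNewformOf W f → ∀ (S₀ : Finset (IsDedekindDomain.HeightOneSpectrum (NumberField.RingOfIntegers ℚ))), (∀ v ∈ S₀, ((2 : ℕ) : NumberField.RingOfIntegers ℚ) ∉ v.asIdeal) → (∀ v : IsDedekindDomain.HeightOneSpectrum (NumberField.RingOfIntegers ℚ), ¬ W.HasGoodReductionAt v → v ∈ S₀) → ∃ n₁ : ℕ, Even n₁ ∧ ∃ s : ZMod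 (2 ^ n₁), ∀ r : ℚ, ‖(∑ k ∈ Fintype.piFinset (fun _ : S₀ ↦ Finset.range 3), (∏ v : S₀, ((W.localPolynomialAt (v : IsDedekindDomain.HeightOneSpectrum (NumberField.RingOfIntegers ℚ))).map (Int.castRingHom (PadicAlgCl 2))).coeff (k v) * ((Rat.HeightOneSpectrum.natGenerator (v : IsDedekindDomain.HeightOneSpectrum (NumberField.RingOfIntegers ℚ)) : PadicAlgCl 2)⁻¹) ^ (k v)) * algebraMap ℚ (PadicAlgCl 2) (ratPlusSymbol f (r * ((∏ v : S₀, Rat.HeightOneSpectrum.natGenerator (v : IsDedekindDomain.HeightOneSpectrum (NumberField.RingOfIntegers ℚ)) ^ (k v) : ℕ) : ℚ))))‖ ≤ ‖(∑ k ∈ Fintype.piFinset (fun _ : S₀ ↦ Finset.range 3), (∏ v : S₀, ((W.localPolynomialAt (v : IsDedekindDomain.HeightOneSpectrum (NumberField.RingOfIntegers ℚ))).map (Int.castRingHom (PadicAlgCl 2))).coeff (k v) * ((Rat.HeightOneSpectrum.natGenerator (v : IsDedekindDomain.HeightOneSpectrum (NumberField.RingOfIntegers ℚ)) : PadicAlgCl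 2)⁻¹) ^ (k v)) * algebraMap ℚ (PadicAlgCl 2) (ratPlusSymbol f ((((((Literature.NumberTheory.EllipticCurves.cyclotomicGenerator 2 : ZMod (2 ^ (n₁ + 2))) ^ s.val).val : ℚ) / (2 : ℚ) ^ (n₁ + 2))) * ((∏ v : S₀, Rat.HeightOneSpectrum.natGenerator (v : IsDedekindDomain.HeightOneSpectrum (NumberField.RingOfIntegers ℚ)) ^ (k v) : ℕ) : ℚ))))‖)
    (hD : Deligne1974_heckeT_eigenvalue_norm_le) :
    Summit.BirchSwinnertonDyer.BirchSwinnertonDyer.Theses.ResidualThetaTransportAtTwo.ThetaLayerLambdaCongruenceAtTwo :=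
  thetaLayerLambdaCongruenceAtTwo_of_plusLineLevel_curveMax_deligne'
    (plusLineAtTwoLevel_of_charTwoLevel (plusLineCharTwo_of_facts hES hF hMK hSD hBz hSe)) hμW hD

end Facts

end Summit.BirchSwinnertonDyer.BirchSwinnertonDyer.Theorems.ThetaLayerLambdaCongruenceAtTwo

end
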